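import Summits.PneNP.PneNP.Theorems.SymmetryBudgetNoHiddenOrderPerPathReplay

/-!
# `NoHiddenOrder` (stmt-PneNP-14781): bridges for the replay circuit — first smallest cell and individualisation

Route `PneNP/SymmetryBudget`; continuation of `SymmetryBudgetNoHiddenOrderKitBridges.lean`.  The replay of the
per-path canoniser (`BranchSum.replay`, `…PerPathReplay.lean`) reads, at every state `(A, col)`, the FIRST
SMALLEST CELL `BranchSum.smallestCell A col` and individualises a vertex by `BranchSum.indiv col x`
(`…PerPathRefine.lean`).  The kit's gadgets (`SymmetricThresholdProgramsMinCell.lean`, formula gates over order/kernel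
wires) compute predicates of the ORDER and KERNEL of `col`; this file identifies them with the definitions:

* `BranchSum.mem_smallestCell_iff_first` — if no cell of `A` is a singleton (true at every replayed state with at
  least two vertices: the block is a switching atom, and singleton cells are switching-isolated), then `a ∈ A` lies in
  `smallestCell A col` iff every `b ∈ A` has a larger cell, or an equally large one of colour `≥ col a` — the
  predicate `MinCell.sem_sel_iff` computes (its `2 ≤ |cell|` guards being automatic);
* `BranchSum.indiv_lt_iff`, `BranchSum.indiv_eq_iff` — order and kernel of the individualised colouring from
  those of `col` (the formula gates feeding the refinement module).
Sorry-free; supports stmt-PneNP-14781, does not close it.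
-/

set_option linter.dupNamespace false -- `Summit.PneNP.PneNP.…` (D-0017 single-conjunct layout)

namespace Summit.PneNP.PneNP.Theorems

open Finset

namespace BranchSum

variable {V : Type*}

/-! ### The first smallest cell through order and kernel -/

/-- The cell of `a` inside `A` is the colour class filter. [folklore] -/
theorem card_cellOf_eq_card_filter (A : Finset V) (col : V → ℕ) (a : V) :
    (cellOf A col a).card = (A.filter fun w => col w = col a).card := rfl

/-- A colour attaining the least cell size is at least the first-smallest-cell colour. [folklore] -/
theorem minColour_le {A : Finset V} (col : V → ℕ) {a : V} (ha : a ∈ A)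
    (hmin : (A.filter fun w => col w = col a).card = minCellCard A col) : minColour A col ≤ col a := by
  have hmem : col a ∈ (A.image col).filter fun k => (A.filter fun w => col w = k).card = minCellCard A col :=
    mem_filter.2 ⟨mem_image_of_mem col ha, hmin⟩
  have hne : ((A.image col).filter fun k => (A.filter fun w => col w = k).card = minCellCard A col).Nonempty :=
    ⟨_, hmem⟩
  unfold minColour
  rw [dif_pos hne]
  exact min'_le _ _ hmem

/-- **The first smallest cell through order and kernel.** If no cell of `A` is a singleton, then `a ∈ A`
lies in `smallestCell A col` iff every `b ∈ A` has a strictly larger cell, or an equally large cell and a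
colour `≥ col a`. [folklore] -/
theorem mem_smallestCell_iff_first {A : Finset V} (col : V → ℕ) {a : V} (ha : a ∈ A) :
    a ∈ smallestCell A col ↔ ∀ b ∈ A,
      (cellOf A col a).card < (cellOf A col b).card ∨
        ((cellOf A col a).card = (cellOf A col b).card ∧ col a ≤ col b) := by
  have hA : A.Nonempty := ⟨a, ha⟩
  obtain ⟨hk₀mem, hk₀card⟩ := minColour_mem col hA
  constructor
  · intro haS b hb
    have hca : col a = minColour A col := (mem_filter.1 haS).2
    have hcard_a : (cellOf A col a).card = minCellCard A col := by
      rw [card_cellOf_eq_card_filter, hca]; exact hk₀card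
    have hle : (cellOf A col a).card ≤ (cellOf A col b).card := by
      rw [hcard_a, card_cellOf_eq_card_filter]; exact minCellCard_le col hb
    rcases hle.lt_or_eq with hlt | heq
    · exact Or.inl hlt
    · refine Or.inr ⟨heq, ?_⟩
      rw [hca]
      exact minColour_le col hb (by rw [← card_cellOf_eq_card_filter, ← heq, hcard_a])
  · intro H
    obtain ⟨b₀, hb₀, hcb₀⟩ := mem_image.1 hk₀mem
    have hcard_b₀ : (cellOf A col b₀).card = minCellCard A col := by
      rw [card_cellOf_eq_card_filter, hcb₀]; exact hk₀card
    have hge : minCellCard A col ≤ (cellOf A col a).card := by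
      rw [card_cellOf_eq_card_filter]; exact minCellCard_le col ha
    rcases H b₀ hb₀ with hlt | ⟨heq, hle⟩
    · rw [hcard_b₀] at hlt; omega
    · have hcard_a : (A.filter fun w => col w = col a).card = minCellCard A col := by
        rw [← card_cellOf_eq_card_filter, heq, hcard_b₀]
      have h1 : minColour A col ≤ col a := minColour_le col ha hcard_a
      rw [hcb₀] at hle
      exact mem_filter.2 ⟨ha, le_antisymm hle h1⟩

/-- Under "no singleton cells" the predicate of the `MinCell` gadget (guards `2 ≤ |cell|` included) is
membership in the first smallest cell. [folklore] -/
theorem mem_smallestCell_iff_minCell {A : Finset V} (col : V → ℕ)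
    (hbig : ∀ b ∈ A, 2 ≤ (cellOf A col b).card) {a : V} (ha : a ∈ A) :
    a ∈ smallestCell A col ↔ 2 ≤ (cellOf A col a).card ∧ ∀ b ∈ A, 2 ≤ (cellOf A col b).card →
      (cellOf A col a).card < (cellOf A col b).card ∨
        ((cellOf A col a).card = (cellOf A col b).card ∧ col a ≤ col b) := by
  rw [mem_smallestCell_iff_first col ha]
  exact ⟨fun H => ⟨hbig a ha, fun b hb _ => H b hb⟩, fun H b hb => H.2 b hb (hbig b hb)⟩

/-! ### Individualisation through order and kernel -/

variable [DecidableEq V]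

/-- **Order of the individualised colouring.** [folklore] -/
theorem indiv_lt_iff (col : V → ℕ) (x u v : V) :
    indiv col x u < indiv col x v ↔ col u < col v ∨ (col u = col v ∧ u ≠ x ∧ v = x) := by
  unfold indiv
  by_cases hu : u = x <;> by_cases hv : v = x <;> simp [hu, hv] <;> omega

/-- **Kernel of the individualised colouring.** [folklore] -/
theorem indiv_eq_iff (col : V → ℕ) (x u v : V) :
    indiv col x u = indiv col x v ↔ col u = col v ∧ (u = x ↔ v = x) := by
  unfold indiv
  by_cases hu : u = x <;> by_cases hv : v = x <;> simp [hu, hv] <;> omega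

end BranchSum

end Summit.PneNP.PneNP.Theorems
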